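import Mathlib
import Summits.ValiantsHypothesis.ValiantsHypothesis.Theorems.DivisionGapZeroOneTransferMmBlockFloor
import Summits.ValiantsHypothesis.ValiantsHypothesis.Theorems.TriangularDimersDivisionEasy.Negative.EdgeIdeal

/-!
# Crux `DivisionGap.ZeroOneTransfer` (stmt-ValiantsHypothesis-5066), line `charged-uncharged`, Part D-I′
(lead c12): MM certificates for `D_n` carry many EDGE variables in every monomial

Composition of Part D-I (`not_mm_certificate_with_sparse_monomial`, p158446: every monomial of a
quasi-polynomial uncharged certificate `X` for `D_n` has at least `n² / 2^((log₂ n + c)^c)` variables)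
with the free NON-EDGE SUBSTITUTION of the crux-4 toolkit (`EdgeIdeal`: the crux's ring has a variable
`x_(v,w)` for every ordered pair of vertices, `D_n` uses only lattice edges, and `x_(v,w) ↦ 1` for the
non-edges costs nothing and fixes `D_n`):

* `not_mm_certificate_with_few_edge_variables` — no constant `c` admits, for every `n`, an `X_n` having a
  monomial with fewer than `n² / 2^((log₂ n + c)^c)` distinct EDGE variables `x_(v,w)`, `v ∼ w`, and
  `L₊(D_n · X_n) ≤ 2^((log₂ n + c)^c)`.  This sharpens both the edge-ideal rung (`h ∈ (x_e : e edge)`,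
  i.e. at least ONE edge variable per monomial) and Part D-I (many variables of any kind): an MM
  certificate for the decisive instance is, monomial by monomial, a dense subgraph-with-multiplicities of
  the rhombus at every quasi-polynomial scale.
[cite: Valiant1980, §3 Thm 1]
-/

noncomputable section

-- `Summit.ValiantsHypothesis.ValiantsHypothesis.…` is the tree's mandated single-conjunct layout
-- (Sub = Summit), so the duplicated namespace component is intended.
set_option linter.dupNamespace false

namespace Summit.ValiantsHypothesis.ValiantsHypothesis.Theorems.DivisionGapZeroOneTransfer

open MvPolynomial
open Literature.Computability.AlgebraicComplexity
open Summit.ValiantsHypothesis.ValiantsHypothesis.Theorems.TriangularDimersDivisionEasy.Negative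
open scoped NNReal BigOperators

namespace MmEdgeFloor

variable {n : ℕ}

/-- The non-edge substitution on a monomial: the edge part of the exponent survives, the rest becomes
`1`. [folklore] -/
theorem substHom_monomial (ν : (Fin n × Fin n) × (Fin n × Fin n) →₀ ℕ) (a : ℝ≥0) :
    substHom (nonEdgeSubst n) (monomial ν a) =
      monomial (ν.filter fun e => Adj e.1 e.2) a := by
  classical
  have hsplit : monomial ν a =
      monomial (ν.filter fun e => Adj e.1 e.2) a *
        monomial (ν.filter fun e => ¬ Adj e.1 e.2) (1 : ℝ≥0) := by
    rw [monomial_mul, mul_one, Finsupp.filter_add_filter_not]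
  rw [hsplit, map_mul]
  -- the edge part is fixed
  have h1 : substHom (nonEdgeSubst n) (monomial (ν.filter fun e => Adj e.1 e.2) a) =
      monomial (ν.filter fun e => Adj e.1 e.2) a := by
    change bind₁ _ (monomial _ a) = _
    rw [bind₁_monomial, monomial_eq, Finsupp.prod]
    congr 1
    refine Finset.prod_congr rfl fun e he => ?_
    have hadj : Adj e.1 e.2 := by
      rw [Finsupp.support_filter, Finset.mem_filter] at he
      exact he.2
    simp only [nonEdgeSubst, if_pos hadj]
  -- the non-edge part becomes `1`
  have h2 : substHom (nonEdgeSubst n) (monomial (ν.filter fun e => ¬ Adj e.1 e.2) (1 : ℝ≥0)) = 1 := by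
    change bind₁ _ (monomial _ (1 : ℝ≥0)) = _
    rw [bind₁_monomial, C_1, one_mul]
    refine Finset.prod_eq_one fun e he => ?_
    have hadj : ¬ Adj e.1 e.2 := by
      rw [Finsupp.support_filter, Finset.mem_filter] at he
      exact he.2
    simp only [nonEdgeSubst, if_neg hadj, C_1, one_pow]
  rw [h1, h2, mul_one]

/-- The edge part of a monomial of `X` is a monomial of the substituted polynomial (no cancellation over
`ℝ≥0`). [folklore] -/
theorem filter_mem_support_substHom {X : MvPolynomial ((Fin n × Fin n) × (Fin n × Fin n)) ℝ≥0}
    {μ : (Fin n × Fin n) × (Fin n × Fin n) →₀ ℕ} (hμ : μ ∈ X.support) :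
    (μ.filter fun e => Adj e.1 e.2) ∈ (substHom (nonEdgeSubst n) X).support := by
  classical
  have hX : substHom (nonEdgeSubst n) X =
      ∑ ν ∈ X.support, monomial (ν.filter fun e => Adj e.1 e.2) (coeff ν X) := by
    conv_lhs => rw [X.as_sum]
    rw [map_sum]
    exact Finset.sum_congr rfl fun ν _ => substHom_monomial ν _
  have hle : coeff μ X ≤ coeff (μ.filter fun e => Adj e.1 e.2) (substHom (nonEdgeSubst n) X) := by
    rw [hX, coeff_sum]
    simp only [coeff_monomial]
    have := Finset.single_le_sum (s := X.support)
      (f := fun ν => if (ν.filter fun e => Adj e.1 e.2) = (μ.filter fun e => Adj e.1 e.2) then coeff ν X else 0)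
      (fun _ _ => _root_.zero_le) hμ
    simp only [if_true] at this
    exact this
  rw [mem_support_iff]
  intro h0
  rw [h0, nonpos_iff_eq_zero] at hle
  exact (mem_support_iff.1 hμ) hle

end MmEdgeFloor

open MmEdgeFloor

/-- **MM certificates for `D_n` carry many EDGE variables in every monomial.**  No constant `c` admits,
for every `n`, an `X_n ∈ ℝ≥0[x]` having a monomial with fewer than `n² / 2^((log₂ n + c)^c)` distinct
edge variables `x_(v,w)` (`v ∼ w` in the triangular rhombus) and `L₊(D_n · X_n) ≤ 2^((log₂ n + c)^c)`:
substitute `1` for the non-edge variables (free, fixes `D_n`; the edge part of the sparse monomial survives)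
and apply Part D-I. [cite: Valiant1980, §3 Thm 1] -/
theorem not_mm_certificate_with_few_edge_variables :
    ¬ ∃ c : ℕ, ∀ n : ℕ, ∃ X : MvPolynomial ((Fin n × Fin n) × (Fin n × Fin n)) ℝ≥0,
      (∃ μ ∈ X.support, (μ.support.filter fun e => Adj e.1 e.2).card * bound c n < n * n) ∧
      complexity (triPM n * X) ≤ bound c n := by
  classical
  rintro ⟨c, H⟩
  refine not_mm_certificate_with_sparse_monomial ⟨c, fun n => ?_⟩
  obtain ⟨X, ⟨μ, hμ, hsparse⟩, hle⟩ := H n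
  refine ⟨substHom (nonEdgeSubst n) X, ⟨μ.filter fun e => Adj e.1 e.2,
    filter_mem_support_substHom hμ, ?_⟩, ?_⟩
  · rw [Finsupp.support_filter]; exact hsparse
  · have h1 := complexity_subst_le (nonEdgeSubst n) (triPM n * X)
    rw [map_mul, substHom_triPM] at h1
    exact h1.trans hle

/-- The same rung for the CHARGED crux 4 (`TriangularDimersDivisionEasy`): successful denominators carry
at least `n² / 2^((log₂ n + c)^c)` distinct edge variables in every monomial. [cite: Valiant1980, §3 Thm 1] -/
theorem not_triDivisionEasy_with_few_edge_variables :
    ¬ ∃ c : ℕ, ∀ n : ℕ, ∃ h : MvPolynomial ((Fin n × Fin n) × (Fin n × Fin n)) ℝ≥0,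
      (∃ μ ∈ h.support, (μ.support.filter fun e => Adj e.1 e.2).card * bound c n < n * n) ∧
      complexity (triPM n * h) + complexity h ≤ bound c n := by
  rintro ⟨c, H⟩
  refine not_mm_certificate_with_few_edge_variables ⟨c, fun n => ?_⟩
  obtain ⟨h, hμ, hle⟩ := H n
  exact ⟨h, hμ, le_of_add_le_left hle⟩

end Summit.ValiantsHypothesis.ValiantsHypothesis.Theorems.DivisionGapZeroOneTransfer

end
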